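import Mathlib
import HarnessLib
import Literature.MathematicalPhysics.StatisticalMechanics.InitialActivityHamiltonian
import Literature.MathematicalPhysics.StatisticalMechanics.RenormalisationMapSmallness

/-!
# The combinatorial factors of the SECOND derivatives against the large-set gain:
# `(x+δ+δ')^m − (x+δ)^m − (x+δ')^m + x^m ≤ m(m−1)δδ'(x+δ+δ')^{m−2}` and `m(m−1)q^{m−2} ≤ 6` for `q ≤ ½`
# ([ABKM19] Lemma 12.2 / (12.20): the factors `|X|^{j₁+j₂}` against `2^{−|X|}`)

Companion of `RenormalisationMapSmallness.add_pow_succ_sub_pow_succ_le` (`(a+δ)^{n+1} − a^{n+1} ≤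
(n+1)δ(a+δ)ⁿ`) and `InitialActivityHamiltonian.succ_mul_pow_le_one_of_le_half` (`(n+1)xⁿ ≤ 1` for
`x ≤ ½`), which control the FIRST differences of polymer products (one derivative: a factor `|X|`).  In
[ABKM19] Lemma 12.2 the constants `C_{j₁}` of the `j₁`-th derivative of `K̂_0 = e^{−ℋ}∏𝒦` come from the
same mechanism with a factor `|X|^{j₁}` absorbed by the gain `2^{−|X|}` ((12.20)); the second-order
versions needed for the mixed second differences (`j₁ + j₂ = 2`) are:

* `secondDiff_pow_le` — `(x+δ+δ')^m − (x+δ)^m − (x+δ')^m + x^m ≤ m(m−1)·δδ'·(x+δ+δ')^{m−2}`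
  (`x, δ, δ' ≥ 0`; natural-number exponent `m − 2`, both sides vanish for `m ≤ 1`);
* `succ_succ_mul_succ_mul_pow_le_six` — `(m+2)(m+1)q^m ≤ 6` for `0 ≤ q ≤ ½`;
* `mul_pred_mul_pow_le_six` — `m(m−1)q^{m−2} ≤ 6`, and `sq_succ_mul_pow_le_six` — `(m+1)²q^m ≤ 6`.

Everything is proved; no named fact.

## References
* S. Adams, S. Buchholz, R. Kotecký, S. Müller, arXiv:1910.13564, Lemma 12.2 (12.9)–(12.10), Lemma 12.3
  (12.20) [AdamsBuchholzKoteckyMuller2019].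
-/

noncomputable section

namespace Literature.MathematicalPhysics.StatisticalMechanics.GradientRG

open Literature.MathematicalPhysics.StatisticalMechanics.TorusPolymer (add_pow_succ_sub_pow_succ_le)

/-- **Second differences of powers**: for `x, δ, δ' ≥ 0`,
`(x+δ+δ')^m − (x+δ)^m − (x+δ')^m + x^m ≤ m(m−1)·δ·δ'·(x+δ+δ')^{m−2}` (the factor `|X|(|X|−1)` of two
derivatives of a product of `|X|` factors). [cite: AdamsBuchholzKoteckyMuller2019, Lemma 12.2 (12.9)–(12.10)] -/
theorem secondDiff_pow_le {x δ δ' : ℝ} (hx : 0 ≤ x) (hδ : 0 ≤ δ) (hδ' : 0 ≤ δ') (m : ℕ) :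
    (x + δ + δ') ^ m - (x + δ) ^ m - (x + δ') ^ m + x ^ m
      ≤ (m : ℝ) * ((m : ℝ) - 1) * δ * δ' * (x + δ + δ') ^ (m - 2) := by
  -- the statement for `m + 2` by induction on `m`, the cases `m = 0, 1` directly
  have key : ∀ n : ℕ, (x + δ + δ') ^ (n + 2) - (x + δ) ^ (n + 2) - (x + δ') ^ (n + 2) + x ^ (n + 2)
      ≤ ((n : ℝ) + 2) * ((n : ℝ) + 1) * δ * δ' * (x + δ + δ') ^ n := by
    intro n
    induction n with
    | zero =>
      have e : (x + δ + δ') ^ (0 + 2) - (x + δ) ^ (0 + 2) - (x + δ') ^ (0 + 2) + x ^ (0 + 2) = 2 * δ * δ' := by ring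
      rw [e]; simp
    | succ n ih =>
      set Y := x + δ + δ' with hY
      have hY0 : 0 ≤ Y := by positivity
      have hxY : x ≤ Y := by linarith
      -- `S_{n+3} = x·S_{n+2} + δ(P₁₁ − P₁₀) + δ'(P₁₁ − P₀₁)`
      have e : Y ^ (n + 1 + 2) - (x + δ) ^ (n + 1 + 2) - (x + δ') ^ (n + 1 + 2) + x ^ (n + 1 + 2)
          = x * (Y ^ (n + 2) - (x + δ) ^ (n + 2) - (x + δ') ^ (n + 2) + x ^ (n + 2))
            + δ * (Y ^ (n + 2) - (x + δ) ^ (n + 2)) + δ' * (Y ^ (n + 2) - (x + δ') ^ (n + 2)) := by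
        rw [hY]; ring
      have h1 : Y ^ (n + 2) - (x + δ) ^ (n + 2) ≤ δ' * ((n + 1 : ℕ) + 1 : ℕ) * Y ^ (n + 1) := by
        have h := add_pow_succ_sub_pow_succ_le (x := x + δ) (δ := δ') (by positivity) hδ' (n + 1)
        rw [← hY] at h
        exact_mod_cast h
      have h2 : Y ^ (n + 2) - (x + δ') ^ (n + 2) ≤ δ * ((n + 1 : ℕ) + 1 : ℕ) * Y ^ (n + 1) := by
        have h := add_pow_succ_sub_pow_succ_le (x := x + δ') (δ := δ) (by positivity) hδ (n + 1)
        have e' : x + δ' + δ = Y := by rw [hY]; ring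
        rw [e'] at h
        exact_mod_cast h
      rw [e]
      have h3 : x * (Y ^ (n + 2) - (x + δ) ^ (n + 2) - (x + δ') ^ (n + 2) + x ^ (n + 2))
          ≤ Y * (((n : ℝ) + 2) * ((n : ℝ) + 1) * δ * δ' * Y ^ n) := by
        refine le_trans (mul_le_mul_of_nonneg_left ih hx) (mul_le_mul_of_nonneg_right hxY ?_)
        positivity
      have hn : (((n + 1 : ℕ) + 1 : ℕ) : ℝ) = (n : ℝ) + 2 := by push_cast; ring
      rw [hn] at h1 h2
      calc x * (Y ^ (n + 2) - (x + δ) ^ (n + 2) - (x + δ') ^ (n + 2) + x ^ (n + 2))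
            + δ * (Y ^ (n + 2) - (x + δ) ^ (n + 2)) + δ' * (Y ^ (n + 2) - (x + δ') ^ (n + 2))
          ≤ Y * (((n : ℝ) + 2) * ((n : ℝ) + 1) * δ * δ' * Y ^ n)
            + δ * (δ' * ((n : ℝ) + 2) * Y ^ (n + 1)) + δ' * (δ * ((n : ℝ) + 2) * Y ^ (n + 1)) :=
            add_le_add (add_le_add h3 (mul_le_mul_of_nonneg_left h1 hδ)) (mul_le_mul_of_nonneg_left h2 hδ')
        _ = (((n + 1 : ℕ) : ℝ) + 2) * (((n + 1 : ℕ) : ℝ) + 1) * δ * δ' * Y ^ (n + 1) := by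
            push_cast; ring
  match m with
  | 0 => simp
  | 1 => simp
  | n + 2 =>
    have h := key n
    have e1 : ((n + 2 : ℕ) : ℝ) = (n : ℝ) + 2 := by push_cast; ring
    rw [e1, show n + 2 - 2 = n from rfl]
    have e2 : ((n : ℝ) + 2 - 1) = (n : ℝ) + 1 := by ring
    rw [e2]
    exact h

/-- `(m+2)(m+1) ≤ 6·2^m`. [cite: AdamsBuchholzKoteckyMuller2019, Lemma 12.3 (12.20)] -/
theorem succ_succ_mul_succ_le_six_mul_two_pow (m : ℕ) : ((m : ℝ) + 2) * ((m : ℝ) + 1) ≤ 6 * 2 ^ m := by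
  induction m with
  | zero => norm_num
  | succ n ih =>
    have h2 : (n : ℝ) + 2 ≤ 3 * 2 ^ n := by
      have h := Nat.lt_two_pow_self (n := n)
      have h' : (n : ℝ) + 1 ≤ 2 ^ n := by exact_mod_cast h
      have h1 : (1 : ℝ) ≤ 2 ^ n := one_le_pow₀ (by norm_num)
      linarith
    push_cast
    rw [pow_succ]
    nlinarith

/-- **`(m+2)(m+1)q^m ≤ 6` for `0 ≤ q ≤ ½`** (the factor `|X|(|X|−1)` against the gain `2^{−|X|}`).
[cite: AdamsBuchholzKoteckyMuller2019, Lemma 12.3 (12.20)] -/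
theorem succ_succ_mul_succ_mul_pow_le_six {q : ℝ} (hq0 : 0 ≤ q) (hq : q ≤ 1 / 2) (m : ℕ) :
    ((m : ℝ) + 2) * ((m : ℝ) + 1) * q ^ m ≤ 6 := by
  have h1 := succ_succ_mul_succ_le_six_mul_two_pow m
  have h2 : q ^ m ≤ (1 / 2) ^ m := pow_le_pow_left₀ hq0 hq m
  calc ((m : ℝ) + 2) * ((m : ℝ) + 1) * q ^ m ≤ 6 * 2 ^ m * (1 / 2) ^ m :=
        mul_le_mul h1 h2 (pow_nonneg hq0 m) (by positivity)
    _ = 6 := by rw [mul_assoc, ← mul_pow]; norm_num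

/-- `m(m−1)q^{m−2} ≤ 6` for `0 ≤ q ≤ ½` (natural-number exponent; trivial for `m ≤ 1`).
[cite: AdamsBuchholzKoteckyMuller2019, Lemma 12.3 (12.20)] -/
theorem mul_pred_mul_pow_le_six {q : ℝ} (hq0 : 0 ≤ q) (hq : q ≤ 1 / 2) (m : ℕ) :
    (m : ℝ) * ((m : ℝ) - 1) * q ^ (m - 2) ≤ 6 := by
  match m with
  | 0 => norm_num
  | 1 => norm_num
  | n + 2 =>
    have h := succ_succ_mul_succ_mul_pow_le_six hq0 hq n
    have e1 : ((n + 2 : ℕ) : ℝ) = (n : ℝ) + 2 := by push_cast; ring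
    rw [e1, show n + 2 - 2 = n from rfl]
    have e2 : ((n : ℝ) + 2 - 1) = (n : ℝ) + 1 := by ring
    rw [e2]; exact h

/-- `(m+1)²q^m ≤ 6` for `0 ≤ q ≤ ½` (two factors `|X|` from two first derivatives).
[cite: AdamsBuchholzKoteckyMuller2019, Lemma 12.3 (12.20)] -/
theorem sq_succ_mul_pow_le_six {q : ℝ} (hq0 : 0 ≤ q) (hq : q ≤ 1 / 2) (m : ℕ) :
    ((m : ℝ) + 1) ^ 2 * q ^ m ≤ 6 := by
  have h := succ_succ_mul_succ_mul_pow_le_six hq0 hq m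
  have h1 : ((m : ℝ) + 1) ^ 2 ≤ ((m : ℝ) + 2) * ((m : ℝ) + 1) := by nlinarith [Nat.cast_nonneg (α := ℝ) m]
  exact le_trans (mul_le_mul_of_nonneg_right h1 (pow_nonneg hq0 m)) h

/-- `(x+δ)^m − x^m ≤ m·δ·(x+δ)^{m−1}` for `x, δ ≥ 0` (natural-number exponent; trivial for `m = 0`).
[cite: AdamsBuchholzKoteckyMuller2019, Lemma 12.2 (12.9)–(12.10)] -/
theorem pow_add_sub_pow_le {x δ : ℝ} (hx : 0 ≤ x) (hδ : 0 ≤ δ) (m : ℕ) :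
    (x + δ) ^ m - x ^ m ≤ (m : ℝ) * δ * (x + δ) ^ (m - 1) := by
  match m with
  | 0 => simp
  | n + 1 =>
    have h := add_pow_succ_sub_pow_succ_le hx hδ n
    rw [show n + 1 - 1 = n from rfl]
    calc (x + δ) ^ (n + 1) - x ^ (n + 1) ≤ δ * ((n + 1 : ℕ) : ℝ) * (x + δ) ^ n := h
      _ = ((n + 1 : ℕ) : ℝ) * δ * (x + δ) ^ n := by ring

/-- `m·q^{m−1} ≤ 1` for `0 ≤ q ≤ ½` (one factor `|X|`; trivial for `m = 0`).
[cite: AdamsBuchholzKoteckyMuller2019, Lemma 12.3 (12.20)] -/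
theorem mul_pow_pred_le_one {q : ℝ} (hq0 : 0 ≤ q) (hq : q ≤ 1 / 2) (m : ℕ) :
    (m : ℝ) * q ^ (m - 1) ≤ 1 := by
  match m with
  | 0 => simp
  | n + 1 =>
    rw [show n + 1 - 1 = n from rfl]
    have h := succ_mul_pow_le_one_of_le_half hq0 hq n
    push_cast
    exact h

end Literature.MathematicalPhysics.StatisticalMechanics.GradientRG

end
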